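import Summits.RiemannHypothesis.RiemannHypothesis.Theorems.S2FormatCDefs
import Literature.Analysis.ValidatedNumerics.DigammaKernelValues
import Literature.Analysis.ValidatedNumerics.IntervalLogArctan
import HarnessLib

/-!
# Format C at `S = {∞, 2}` — the (E0) input-table CHECKER (definitions)

File 2/4 of the (E0) base (seat cc-s2-4, `HOME/cc-s2-4/CC4-LEAN.md` §9.2; LEAD RULING R7-13).  An (E0) rung file ships
a LITERAL table `T : EntryInputs` and a literal `E0.Aux` — produced by `#eval E0.mkTable` (the Lean VM is the generator;
no external mirror of the interval engine) — and the kernel RE-DERIVES every box with the tree's `NumericsMP` primitives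
(`MI.piMachin`, `MI.logTwo`, `MI.logPos`, `MI.exp`, `MC.expI`, `MC.digammaBox`, `MC.trigammaBox` + `MC.bernoulliTable`)
and checks INCLUSION in the literal: `E0.checkA` (scalars + auxiliary boxes) and the mode-BANDED `E0.checkB/Bd/C/Cp/D`
(`decide +kernel`, ≤ 32–64 modes per band at `S = 2^64`; bands glued by `E0.check*_append` with numeral ends so the
elaborator never unfolds the literal).  The infinite `e_k`-sums (`S0`, `S2`, `Sdiag`, `E`, `E₂`) are truncated at `Ke`
terms with a geometric tail box (`e_{K+j} = e_K r^j`, `r = e^{−4b}`).  Soundness (`E0.valid_of_checks : … → T.Valid b`)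
is files 3–4.  Measured (farm, `b = 139/250`): even-sector sizes `(M₁,M₃) = (32,128)` in one 110-s file, odd-sector sizes
`(128,512)` ≈ 470 kernel-s in 5 files.
-/

set_option linter.dupNamespace false
set_option autoImplicit false

noncomputable section

open Complex Set MeasureTheory Filter Finset
open scoped Real Topology ComplexConjugate BigOperators

namespace Summit.RiemannHypothesis.RiemannHypothesis.Theorems.S2FormatC

open Literature.Analysis.SpecialFunctions

section E0
open Literature.Analysis.ValidatedNumerics.NumericsMP

namespace E0

/-! ### Box inclusion -/

/-- `I ⊆ J` for kernel boxes. -/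
def incl (I J : MI) : Bool := decide (J.lo ≤ I.lo) && decide (I.hi ≤ J.hi)

/-- `I ⊆ J` transports membership. -/
theorem mem_of_incl {S : ℕ} {x : ℝ} {I J : MI} (hx : MI.mem S x I) (h : incl I J = true) :
    MI.mem S x J := by
  simp only [incl, Bool.and_eq_true, decide_eq_true_eq] at h
  exact ⟨(Int.cast_le.2 h.1).trans hx.1, hx.2.trans (Int.cast_le.2 h.2)⟩

/-- `o = some I` with `I ⊆ J`. -/
def optIncl : Option MI → MI → Bool
  | some I, J => incl I J
  | none, _ => false

/-- `optIncl o J` transports membership from the computed box to the literal one. -/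
theorem mem_of_optIncl {S : ℕ} {x : ℝ} {o : Option MI} {J : MI} (h : optIncl o J = true)
    (hx : ∀ I, o = some I → MI.mem S x I) : MI.mem S x J := by
  cases o with
  | none => exact absurd h (by simp [optIncl])
  | some I => exact mem_of_incl (hx I rfl) h

/-! ### Generator knobs and the auxiliary literal boxes -/

/-- Knobs of the (E0) generator/checker: the window `b = bnum/bden` and the series orders. -/
structure Params where
  /-- window `b = bnum/bden` -/
  bnum : ℕ
  bden : ℕ
  /-- Machin arctan terms for `π` -/
  Kpi : ℕ
  /-- series terms for `log 2`, `log π` -/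
  Klog : ℕ
  /-- `exp`: Taylor terms and argument halvings -/
  Kexp : ℕ
  kexp : ℕ
  /-- `e^{iθ}`: Taylor terms and argument halvings -/
  KexpI : ℕ
  kexpI : ℕ
  /-- `ψ`: log-series terms and Stirling shift -/
  Kpsi : ℕ
  Jpsi : ℕ
  /-- truncation of the `e_k`-sums (terms `k < Ke`, tail from `k = Ke`) -/
  Ke : ℕ
  deriving Repr

/-- Auxiliary literal boxes shared by the per-mode checks: `r = e^{−4b}`, `e_k` (`k = 0 … Ke`), `ω_n` (`n = 0 … M₃`). -/
structure Aux where
  rBox : MI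
  eBox : List MI
  omBox : List MI
  deriving Repr

/-! ### The box builders (shared by generator and checker) -/

/-- `ω_n = π·n·bden/bnum`. -/
def omBoxOf (T : EntryInputs) (P : Params) (n : ℕ) : MI :=
  (T.piBox.mulInt ((n * P.bden : ℕ) : ℤ)).divNat P.bnum

/-- `exp (p/q)`. -/
def expFrac (T : EntryInputs) (P : Params) (p : ℤ) (q : ℕ) : Option MI :=
  MI.exp T.S P.Kexp P.kexp (MI.ofFrac T.S p q)

/-- `e_k = e^{−b(4k+1)}`. -/
def eBoxOf (T : EntryInputs) (P : Params) (k : ℕ) : Option MI :=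
  expFrac T P (-((P.bnum * (4 * k + 1) : ℕ) : ℤ)) P.bden

/-- `r = e^{−4b}`. -/
def rBoxOf (T : EntryInputs) (P : Params) : Option MI :=
  expFrac T P (-((4 * P.bnum : ℕ) : ℤ)) P.bden

/-- The point `w_n = ¼ + iω_n/2` as a box. -/
def wBoxOf (T : EntryInputs) (X : Aux) (n : ℕ) : MC :=
  MC.mk' (MI.ofFrac T.S 1 4) ((X.omBox.getD n default).divNat 2)

/-- `ψ(w_n)`. -/
def psiBoxOf (T : EntryInputs) (P : Params) (X : Aux) (n : ℕ) : Option MC :=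
  MC.digammaBox T.S P.Kpsi P.Jpsi T.piBox MC.bernoulliTable (wBoxOf T X n)

/-- `ψ′(w_n)`. -/
def psi'BoxOf (T : EntryInputs) (P : Params) (X : Aux) (n : ℕ) : Option MC :=
  MC.trigammaBox T.S P.Jpsi MC.bernoulliTable (wBoxOf T X n)

/-- `θ_n = ω_n log 2`. -/
def thetaBoxOf (T : EntryInputs) (X : Aux) (n : ℕ) : MI :=
  (X.omBox.getD n default).mul T.S T.logTwoBox

/-- `e^{iθ_n}`. -/
def cisBoxOf (T : EntryInputs) (P : Params) (X : Aux) (n : ℕ) : Option MC :=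
  MC.expI T.S P.KexpI P.kexpI T.piBox (thetaBoxOf T X n)

/-- `l_k² = (4k+1)²/4`. -/
def lSqBox (S : ℕ) (k : ℕ) : MI := MI.ofFrac S (((4 * k + 1) ^ 2 : ℕ) : ℤ) 4

/-- `l_k² + ω_n²`. -/
def denBoxOf (T : EntryInputs) (X : Aux) (n k : ℕ) : MI :=
  (lSqBox T.S k).add ((X.omBox.getD n default).sqr T.S)

/-- term of `S0_n`: `e_k/(l_k² + ω_n²)`. -/
def termS0 (T : EntryInputs) (X : Aux) (n k : ℕ) : Option MI :=
  MI.divPos T.S (X.eBox.getD k default) (denBoxOf T X n k)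

/-- term of `S2_n`: `e_k l_k²/(l_k² + ω_n²)`. -/
def termS2 (T : EntryInputs) (X : Aux) (n k : ℕ) : Option MI :=
  MI.divPos T.S ((X.eBox.getD k default).mul T.S (lSqBox T.S k)) (denBoxOf T X n k)

/-- term of `Sdiag_n`: `e_k (l_k² − ω_n²)/(l_k² + ω_n²)²`. -/
def termSdiag (T : EntryInputs) (X : Aux) (n k : ℕ) : Option MI :=
  MI.divPos T.S ((X.eBox.getD k default).mul T.S ((lSqBox T.S k).sub ((X.omBox.getD n default).sqr T.S)))
    ((denBoxOf T X n k).sqr T.S)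

/-- term of `E`: `e_k`. -/
def termETot (X : Aux) (k : ℕ) : Option MI := some (X.eBox.getD k default)

/-- term of `E₂`: `e_k l_k²`. -/
def termETwo (T : EntryInputs) (X : Aux) (k : ℕ) : Option MI :=
  some ((X.eBox.getD k default).mul T.S (lSqBox T.S k))

/-- Box of a partial sum `Σ_{k<K}` of boxed terms (`none` if a term fails). -/
def psum (f : ℕ → Option MI) : ℕ → Option MI
  | 0 => some ⟨0, 0⟩
  | k + 1 =>
    match psum f k, f k with
    | some A, some B => some (A.add B)
    | _, _ => none

/-- Scaled ceiling of the geometric tail bound `a·(p/q)/(1 − r)` from `a ≤ A.hi/S`, `r ≤ R.hi/S < 1`. -/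
def tailHi (S : ℕ) (A R : MI) (p q : ℕ) : ℤ :=
  Literature.Analysis.ValidatedNumerics.Numerics.cdiv (max A.hi 0 * p * S) (((S : ℤ) - R.hi) * q)

/-- One-sided tail box `[0, tailHi]`. -/
def tailBox (S : ℕ) (A R : MI) (p q : ℕ) : MI := ⟨0, tailHi S A R p q⟩

/-- Symmetric tail box `[−tailHi, tailHi]`. -/
def tailBoxSym (S : ℕ) (A R : MI) (p q : ℕ) : MI := ⟨-tailHi S A R p q, tailHi S A R p q⟩

/-- `ρ = r·((4K+5)/(4K+1))²` (ratio majorant of `e_k l_k²` beyond `K`). -/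
def rhoBox (P : Params) (X : Aux) : MI :=
  (X.rBox.mulInt (((4 * P.Ke + 5) ^ 2 : ℕ) : ℤ)).divNat ((4 * P.Ke + 1) ^ 2)

/-- Adds a tail box to an optional partial sum. -/
def addTail : Option MI → MI → Option MI
  | some A, Tl => some (A.add Tl)
  | none, _ => none

/-- `S0_n` box. -/
def S0BoxOf (T : EntryInputs) (P : Params) (X : Aux) (n : ℕ) : Option MI :=
  addTail (psum (termS0 T X n) P.Ke) (tailBox T.S (X.eBox.getD P.Ke default) X.rBox 4 ((4 * P.Ke + 1) ^ 2))

/-- `S2_n` box. -/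
def S2BoxOf (T : EntryInputs) (P : Params) (X : Aux) (n : ℕ) : Option MI :=
  addTail (psum (termS2 T X n) P.Ke) (tailBox T.S (X.eBox.getD P.Ke default) X.rBox 1 1)

/-- `Sdiag_n` box. -/
def SdiagBoxOf (T : EntryInputs) (P : Params) (X : Aux) (n : ℕ) : Option MI :=
  addTail (psum (termSdiag T X n) P.Ke) (tailBoxSym T.S (X.eBox.getD P.Ke default) X.rBox 4 ((4 * P.Ke + 1) ^ 2))

/-- `E` box. -/
def eTotBoxOf (T : EntryInputs) (P : Params) (X : Aux) : Option MI :=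
  addTail (psum (termETot X) P.Ke) (tailBox T.S (X.eBox.getD P.Ke default) X.rBox 1 1)

/-- `E₂` box. -/
def eTwoBoxOf (T : EntryInputs) (P : Params) (X : Aux) : Option MI :=
  addTail (psum (termETwo T X) P.Ke) (tailBox T.S (X.eBox.getD P.Ke default) (rhoBox P X) ((4 * P.Ke + 1) ^ 2) 4)

/-- `s² = (e^{b/2} − e^{−b/2})²`. -/
def sSqBoxOf (T : EntryInputs) (P : Params) : Option MI :=
  match expFrac T P (P.bnum : ℤ) (2 * P.bden), expFrac T P (-(P.bnum : ℤ)) (2 * P.bden) with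
  | some A, some B => some ((A.sub B).sqr T.S)
  | _, _ => none

/-! ### The Boolean checks: (A) scalars + auxiliary boxes; (B)/(C)/(D) per-mode BANDS `n₀ ≤ n < n₀ + k`
(the per-`decide` kernel budget ≈ 60–75 s forces ≤ ~250 modes per band for (C)/(D) at `S = 2^64`; bands are glued
by `band_append`, definitional arithmetic only) -/

/-- (A) scalars and auxiliary boxes. -/
def checkA (P : Params) (T : EntryInputs) (X : Aux) : Bool :=
  decide (0 < T.S) && decide (0 < P.bnum) && decide (0 < P.bden) &&
  optIncl (MI.piMachin T.S P.Kpi) T.piBox &&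
  optIncl (MI.logTwo T.S P.Klog) T.logTwoBox &&
  optIncl (MI.logPos T.S P.Klog T.piBox) T.logPiBox &&
  optIncl (MI.exp T.S P.Kexp P.kexp (T.logTwoBox.divNat 2)) T.sqrtTwoBox &&
  optIncl (sSqBoxOf T P) T.sSqBox &&
  optIncl (rBoxOf T P) X.rBox && decide (X.rBox.hi < T.S) && decide ((rhoBox P X).hi < T.S) &&
  (List.range (P.Ke + 1)).all (fun k ↦ optIncl (eBoxOf T P k) (X.eBox.getD k default)) &&
  (List.range (T.M₃ + 1)).all (fun n ↦ incl (omBoxOf T P n) (X.omBox.getD n default)) &&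
  optIncl (eTotBoxOf T P X) T.eTotBox &&
  optIncl (eTwoBoxOf T P X) T.eTwoBox

/-- (B) the `e_k`-sums `S0_n`, `S2_n` on the band `n₀ ≤ n < n₀ + k` (modes `≤ M₃`). -/
def checkB (P : Params) (T : EntryInputs) (X : Aux) (n₀ k : ℕ) : Bool :=
  (List.range' n₀ k).all (fun n ↦
    optIncl (S0BoxOf T P X n) (T.S0Box.getD n default) && optIncl (S2BoxOf T P X n) (T.S2Box.getD n default))

/-- (B′) `Sdiag_n` on a band (modes `≤ M₁`). -/
def checkBd (P : Params) (T : EntryInputs) (X : Aux) (n₀ k : ℕ) : Bool :=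
  (List.range' n₀ k).all (fun n ↦ optIncl (SdiagBoxOf T P X n) (T.SdiagBox.getD n default))

/-- (C) `ψ(w_n)` on a band: `Im` for every mode, `Re` for the modes `≤ M₁ + 1`. -/
def checkC (P : Params) (T : EntryInputs) (X : Aux) (n₀ k : ℕ) : Bool :=
  (List.range' n₀ k).all (fun n ↦
    match psiBoxOf T P X n with
    | some Y => incl Y.im (T.imPsiBox.getD n default) &&
        (!decide (n ≤ T.M₁ + 1) || incl Y.re (T.rePsiBox.getD n default))
    | none => false)

/-- (C′) `Re ψ′(w_n)` on a band (modes `≤ M₁`). -/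
def checkCp (P : Params) (T : EntryInputs) (X : Aux) (n₀ k : ℕ) : Bool :=
  (List.range' n₀ k).all (fun n ↦
    match psi'BoxOf T P X n with
    | some Y => incl Y.re (T.rePsi'Box.getD n default)
    | none => false)

/-- (D) `cos`, `sin (ω_n log 2)` on a band. -/
def checkD (P : Params) (T : EntryInputs) (X : Aux) (n₀ k : ℕ) : Bool :=
  (List.range' n₀ k).all (fun n ↦
    match cisBoxOf T P X n with
    | some C => incl C.re (T.cosBox.getD n default) && incl C.im (T.sinBox.getD n default)
    | none => false)

/-- Band gluing (for every banded check): `[n₀, n₀+k) ∪ [n₀+k, n₀+k+k') = [n₀, n₀+(k+k'))`. -/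
theorem band_append {f : ℕ → Bool} {n₀ k k' : ℕ} (h1 : (List.range' n₀ k).all f = true)
    (h2 : (List.range' (n₀ + k) k').all f = true) : (List.range' n₀ (k + k')).all f = true := by
  simp only [List.all_eq_true, List.mem_range'_1] at h1 h2 ⊢
  intro n hn
  by_cases h : n < n₀ + k
  · exact h1 n ⟨hn.1, h⟩
  · exact h2 n ⟨by omega, by omega⟩

/-- Band gluing for `checkB` with numeral ends (per-rung files never let the elaborator unfold the table). -/
theorem checkB_append {P : Params} {T : EntryInputs} {X : Aux} {n₀ k n₁ k' K : ℕ} (e₁ : n₀ + k = n₁)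
    (e₂ : k + k' = K) (h1 : checkB P T X n₀ k = true) (h2 : checkB P T X n₁ k' = true) :
    checkB P T X n₀ K = true := by
  subst e₁ e₂; exact band_append h1 h2

/-- Band gluing for `checkBd`. -/
theorem checkBd_append {P : Params} {T : EntryInputs} {X : Aux} {n₀ k n₁ k' K : ℕ} (e₁ : n₀ + k = n₁)
    (e₂ : k + k' = K) (h1 : checkBd P T X n₀ k = true) (h2 : checkBd P T X n₁ k' = true) :
    checkBd P T X n₀ K = true := by
  subst e₁ e₂; exact band_append h1 h2

/-- Band gluing for `checkC`. -/
theorem checkC_append {P : Params} {T : EntryInputs} {X : Aux} {n₀ k n₁ k' K : ℕ} (e₁ : n₀ + k = n₁)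
    (e₂ : k + k' = K) (h1 : checkC P T X n₀ k = true) (h2 : checkC P T X n₁ k' = true) :
    checkC P T X n₀ K = true := by
  subst e₁ e₂; exact band_append h1 h2

/-- Band gluing for `checkCp`. -/
theorem checkCp_append {P : Params} {T : EntryInputs} {X : Aux} {n₀ k n₁ k' K : ℕ} (e₁ : n₀ + k = n₁)
    (e₂ : k + k' = K) (h1 : checkCp P T X n₀ k = true) (h2 : checkCp P T X n₁ k' = true) :
    checkCp P T X n₀ K = true := by
  subst e₁ e₂; exact band_append h1 h2

/-- Band gluing for `checkD`. -/
theorem checkD_append {P : Params} {T : EntryInputs} {X : Aux} {n₀ k n₁ k' K : ℕ} (e₁ : n₀ + k = n₁)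
    (e₂ : k + k' = K) (h1 : checkD P T X n₀ k = true) (h2 : checkD P T X n₁ k' = true) :
    checkD P T X n₀ K = true := by
  subst e₁ e₂; exact band_append h1 h2

/-! ### The generator (VM only; nothing is proved about it — the checker re-derives everything) -/

/-- `Option`-list helper. -/
def olist (N : ℕ) (f : ℕ → Option MI) : List MI := (List.range N).map (fun n ↦ (f n).getD default)

/-- Build the table and the auxiliary boxes for `(S, M₁, M₃)` (literal data for the (E0) file; `#eval`). -/
def mkTable (P : Params) (S M₁ M₃ : ℕ) : EntryInputs × Aux :=
  let pi := (MI.piMachin S P.Kpi).getD default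
  let l2 := (MI.logTwo S P.Klog).getD default
  let T0 : EntryInputs := ⟨S, M₁, M₃, [], [], [], [], [], [], [], [], pi, (MI.logPos S P.Klog pi).getD default, l2,
    (MI.exp S P.Kexp P.kexp (l2.divNat 2)).getD default, default, default, default⟩
  let X0 : Aux := ⟨(rBoxOf T0 P).getD default, olist (P.Ke + 1) (eBoxOf T0 P), (List.range (M₃ + 1)).map (omBoxOf T0 P)⟩
  let psi := (List.range (M₃ + 1)).map (fun n ↦ (psiBoxOf T0 P X0 n).getD default)
  let psi' := (List.range (M₁ + 1)).map (fun n ↦ (psi'BoxOf T0 P X0 n).getD default)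
  let cis := (List.range (M₃ + 1)).map (fun n ↦ (cisBoxOf T0 P X0 n).getD default)
  let T : EntryInputs := ⟨S, M₁, M₃, (psi.take (M₁ + 2)).map MC.re, psi'.map MC.re, psi.map MC.im,
    cis.map MC.im, cis.map MC.re, olist (M₃ + 1) (S0BoxOf T0 P X0), olist (M₃ + 1) (S2BoxOf T0 P X0),
    olist (M₁ + 1) (SdiagBoxOf T0 P X0), T0.piBox, T0.logPiBox, T0.logTwoBox, T0.sqrtTwoBox,
    (eTotBoxOf T0 P X0).getD default, (eTwoBoxOf T0 P X0).getD default, (sSqBoxOf T0 P).getD default⟩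
  (T, X0)


/-! ### The facts a sound `checkA` delivers (proved in file 3) -/

section AFactsDef

variable {P : Params} {T : EntryInputs} {X : Aux} {b : ℝ}

/-- The facts extracted from `checkA` (and `b = bnum/bden`). -/
structure AFacts (P : Params) (T : EntryInputs) (X : Aux) (b : ℝ) : Prop where
  hS : 0 < T.S
  hbnum : 0 < P.bnum
  hbden : 0 < P.bden
  hb : b = P.bnum / P.bden
  pi : MI.mem T.S π T.piBox
  logTwo : MI.mem T.S (Real.log 2) T.logTwoBox
  logPi : MI.mem T.S (Real.log π) T.logPiBox
  sqrtTwo : MI.mem T.S (Real.sqrt 2) T.sqrtTwoBox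
  sSq : MI.mem T.S (S2FormatC.sSq b) T.sSqBox
  r : MI.mem T.S (Real.exp (-(4 * b))) X.rBox
  rlt : X.rBox.hi < T.S
  rholt : (rhoBox P X).hi < T.S
  e : ∀ k ≤ P.Ke, MI.mem T.S (eNode b k) (X.eBox.getD k default)
  om : ∀ n ≤ T.M₃, MI.mem T.S (omega b n) (X.omBox.getD n default)
  eTot : MI.mem T.S (S2FormatC.eTot b) T.eTotBox
  eTwo : MI.mem T.S (S2FormatC.eTwo b) T.eTwoBox

end AFactsDef

end E0

end E0

end Summit.RiemannHypothesis.RiemannHypothesis.Theorems.S2FormatC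

end
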